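import Mathlib
import Summits.ValiantsHypothesis.ValiantsHypothesis.Theorems.GirthSidonMomentCurveElusiveCoveringGirth
import Summits.ValiantsHypothesis.ValiantsHypothesis.Theorems.GirthSidonPolySwallowForcesShortRelationBornRank

/-!
# Route GirthSidon — crux `PolySwallowForcesShortRelation` (stmt-ValiantsHypothesis-6537), line
`two_ended_honesty`: the SUPPORT-SUMSET sub-regimes (pigeonhole in `60•A`, Plünnecke–Ruzsa, girth on `A`)

Setting of the line's residual `stub_totallyBornTargets`: a quadratic polynomial swallowing
`Γ_i(y) = x^{d_i}` (`i < m`), sources `y_j ∈ ℂ[x]`.  Let `A ⊂ ℕ` be any finite set containing `0`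
and the exponent support of every source (the POOL of the refuter's census
`Cruxes/PolySwallowForcesShortRelation/TERMHOP-d1.md`, enlarged by the source supports).  Then every
target exponent is a pair sum, `d_i ∈ A + A` (`target_mem_sumset`: `Γ_i(y) ∈ span(W·W)`,
`W = span(1, y) ≤ span{x^a : a ∈ A}`, and `span{x^a} · span{x^b} ≤ span{x^c : c ∈ A + A}`), and a
relation-free exponent vector (no two distinct multisets of `≤ 30` indices with equal `d`-sums) has
`C(m+29, 30)` DISTINCT sums of `30`-multisets, all inside the iterated sumset `30 • (A + A) = 60 • A`.
Hence each of the following forces a short relation (no honesty hypothesis, no girth):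

* `relation_of_card_nsmul_lt` — the targets lie in a set `B` with `#(30 • B) < C(m+29, 30)`
  (the common generalisation of the height lemma `PolySwallowHeight.relation_of_height`, `B = [0, H]`,
  and of every "GAP / box / rank-collapse ⇒ pigeonhole" verdict of the censuses REDUCTION-p2 §6 and
  TERMHOP-d1 §2);
* `relation_of_sumset_cover` — `d_i ∈ A + A` with `#(60 • A) < C(m+29, 30)`;
* `relation_of_small_doubling` — `d_i ∈ A + A` with `#(A + A)^60 < C(m+29, 30) · #A^59`, by the
  Plünnecke–Ruzsa inequality `#(60 • A) · #A^59 ≤ #(A + A)^60` (Mathlib's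
  `Finset.pluennecke_ruzsa_inequality_nsmul_add`, transported from `ℤ` to `ℕ`:
  `card_nsmul_mul_pow_le`); in doubling form `#(A + A) ≤ K · #A`, `K^60 · #A < C(m+29, 30)`
  (`relation_of_doubling_le`);
* `relation_of_support_card` — `#A^20 ≤ m^19`, `m ≥ 4098^25`: the girth engine
  `Theorems.stub_coveringGirth` on the cover `d ⊆ A + A` (the sparse engine of item 6539 counted by the
  total support instead of `s · B`).

For the line: a counterexample to `stub_totallyBornTargets` (equivalently, by
`PolySwallowGlue.polySwallow_of_totallyBorn`, to the crux) must have a pool `A` with `#A > m^{19/20}`,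
`#(60 • A) ≥ C(m+29,30) ≈ m^30/30!` and doubling `#(A+A)/#A > (C(m+29,30)/#A)^{1/60} ≈ 0.29 · m^{1/2} / #A^{1/60}`
(`counterexample_support_shape`) — polynomially large doubling, on top of the necessary conditions of
`PolySwallowShape.counterexample_shape`.  This kills, in kernel, every design whose exponents live in a
low-rank lattice image of small volume (digit/box pools, dense random pools, the "DEAD-rank" rows of
TERMHOP-d1 §2), uniformly and without knowing the structure.  It does NOT touch free-height designs
(TERMHOP-d1 §1: heights are free there, doubling ≈ #A/2); the residual stays conjecture-grade and
VP ≠ VNP is not moved. [folklore; Plünnecke–Ruzsa as in Mathlib, cite: TaoVu2006 Cor. 6.29]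
-/

-- Sub = Summit layout duplicates the namespace component
set_option linter.dupNamespace false

namespace Summit.ValiantsHypothesis.ValiantsHypothesis.Theorems

open Polynomial
open scoped Pointwise

namespace PolySwallowSupport

/-! ## Pigeonhole in an iterated sumset -/

section Pigeonhole

variable {α : Type*} [AddCommMonoid α] [DecidableEq α]

/-- The sum of a multiset all of whose elements lie in `B` lies in the iterated sumset
`(card M) • B`. [folklore] -/
theorem multiset_sum_mem_nsmul (B : Finset α) (M : Multiset α) (hM : ∀ x ∈ M, x ∈ B) :
    M.sum ∈ (Multiset.card M) • B := by
  induction M using Multiset.induction_on with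
  | empty => simp
  | cons a M ih =>
    rw [Multiset.sum_cons, Multiset.card_cons, succ_nsmul']
    exact Finset.add_mem_add (hM a (Multiset.mem_cons_self a M))
      (ih fun x hx => hM x (Multiset.mem_cons_of_mem hx))

/-- **Pigeonhole in `k • B`.**  If every `d_i` lies in a finite set `B` whose `k`-fold iterated
sumset has fewer than `C(m+k-1, k)` elements (the number of `k`-multisets of indices), two distinct
`k`-multisets of indices have the same `d`-sum.  With `k = 30`, `B = [0, H]` this is the height lemma
`PolySwallowHeight.relation_of_height`. [folklore] -/
theorem relation_of_card_nsmul_lt {m k : ℕ} (d : Fin m → α) (B : Finset α) (hd : ∀ i, d i ∈ B)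
    (hB : (k • B).card < Nat.choose (m + k - 1) k) :
    ∃ S T : Multiset (Fin m), S ≠ T ∧ Multiset.card S ≤ k ∧ Multiset.card T ≤ k ∧
      (S.map d).sum = (T.map d).sum := by
  classical
  have hsum : ∀ S : Sym (Fin m) k, ((S : Multiset (Fin m)).map d).sum ∈ k • B := by
    intro S
    have h := multiset_sum_mem_nsmul B ((S : Multiset (Fin m)).map d) (by
      intro x hx
      obtain ⟨i, -, rfl⟩ := Multiset.mem_map.mp hx
      exact hd i)
    simpa only [Multiset.card_map, Sym.card_coe] using h
  let F : Sym (Fin m) k → (k • B : Finset α) := fun S => ⟨_, hsum S⟩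
  have hcard : Fintype.card (k • B : Finset α) < Fintype.card (Sym (Fin m) k) := by
    rw [Fintype.card_coe, Sym.card_sym_eq_multichoose, Fintype.card_fin, Nat.multichoose_eq]
    exact hB
  obtain ⟨S, T, hne, hST⟩ := Fintype.exists_ne_map_eq_of_card_lt F hcard
  refine ⟨S, T, fun h => hne (Subtype.ext h), by simp, by simp, ?_⟩
  simpa [F] using congrArg Subtype.val hST

/-- **Pigeonhole in `2k • A` for a sumset cover.**  If every `d_i ∈ A + A` and
`#((2k) • A) < C(m+k-1, k)`, a relation of length `≤ k` exists (`k • (A + A) = (2k) • A`).  Used below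
with `k = 30`: `#(60 • A) < C(m+29, 30)`. [folklore] -/
theorem relation_of_sumset_cover {m k : ℕ} (d : Fin m → α) (A : Finset α) (hd : ∀ i, d i ∈ A + A)
    (hA : ((2 * k) • A).card < Nat.choose (m + k - 1) k) :
    ∃ S T : Multiset (Fin m), S ≠ T ∧ Multiset.card S ≤ k ∧ Multiset.card T ≤ k ∧
      (S.map d).sum = (T.map d).sum := by
  refine relation_of_card_nsmul_lt d (A + A) hd ?_
  have h : k • (A + A) = (2 * k) • A := by
    rw [nsmul_add, two_mul, add_nsmul]
  rwa [h]

end Pigeonhole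

/-! ## Plünnecke–Ruzsa, transported to `ℕ` -/

section Doubling

/-- **Plünnecke–Ruzsa for exponent sets** (denominators cleared, `ℕ`-valued): for a nonempty finite
`A ⊂ ℕ` and every `n`, `#(n • A) · #A^n ≤ #(A + A)^n · #A`.  Transport of Mathlib's
`Finset.pluennecke_ruzsa_inequality_nsmul_add` along `ℕ ↪ ℤ`. [cite: TaoVu2006, Cor. 6.29] -/
theorem card_nsmul_mul_pow_le (A : Finset ℕ) (hA : A.Nonempty) (n : ℕ) :
    (n • A).card * A.card ^ n ≤ (A + A).card ^ n * A.card := by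
  classical
  set f : ℕ →+ ℤ := Nat.castAddMonoidHom ℤ with hf
  have hfinj : Function.Injective f := fun a b h => by
    simpa [hf] using h
  set Az : Finset ℤ := A.image f with hAz
  have hcardA : Az.card = A.card := Finset.card_image_of_injective _ hfinj
  have hcardAA : (Az + Az).card = (A + A).card := by
    rw [hAz, ← Finset.image_add, Finset.card_image_of_injective _ hfinj]
  have hcardnA : (n • Az).card = (n • A).card := by
    have h : n • Az = (n • A).image f := by
      have := map_nsmul (Finset.imageAddMonoidHom f) n A
      simpa [hAz] using this.symm
    rw [h, Finset.card_image_of_injective _ hfinj]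
  have hne : Az.Nonempty := by simpa [hAz] using hA
  have hP := Finset.pluennecke_ruzsa_inequality_nsmul_add hne Az n
  have hA0 : (Az.card : ℚ≥0) ≠ 0 := by exact_mod_cast hne.card_pos.ne'
  have key : ((n • Az).card : ℚ≥0) * (Az.card : ℚ≥0) ^ n ≤
      ((Az + Az).card : ℚ≥0) ^ n * (Az.card : ℚ≥0) := by
    calc ((n • Az).card : ℚ≥0) * (Az.card : ℚ≥0) ^ n
        ≤ ((((Az + Az).card : ℚ≥0) / Az.card) ^ n * Az.card) * (Az.card : ℚ≥0) ^ n :=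
          by gcongr
      _ = ((Az + Az).card : ℚ≥0) ^ n * (Az.card : ℚ≥0) := by
          rw [div_pow, div_mul_eq_mul_div, div_mul_eq_mul_div, div_eq_iff (pow_ne_zero n hA0)]
  rw [hcardA, hcardAA, hcardnA] at key
  exact_mod_cast key

variable {α : Type*}

/-- **Small doubling of the pool forces a relation.**  If every `d_i ∈ A + A` for a finite `A ⊂ ℕ`
with `#(A + A)^60 < C(m+29, 30) · #A^59`, a relation of length `≤ 30` exists: Plünnecke–Ruzsa gives
`#(60 • A) · #A^59 ≤ #(A + A)^60`, then pigeonhole in `60 • A`. [cite: TaoVu2006, Cor. 6.29] -/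
theorem relation_of_small_doubling {m : ℕ} (d : Fin m → ℕ) (A : Finset ℕ) (hd : ∀ i, d i ∈ A + A)
    (hA : (A + A).card ^ 60 < Nat.choose (m + 29) 30 * A.card ^ 59) :
    ∃ S T : Multiset (Fin m), S ≠ T ∧ Multiset.card S ≤ 30 ∧ Multiset.card T ≤ 30 ∧
      (S.map d).sum = (T.map d).sum := by
  classical
  rcases A.eq_empty_or_nonempty with rfl | hne
  · simp at hA
  refine relation_of_sumset_cover (k := 30) d A hd ?_
  have hP := card_nsmul_mul_pow_le A hne 60
  have hpos : 0 < A.card := hne.card_pos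
  -- `#(60•A) · #A^60 ≤ #(A+A)^60 · #A < C · #A^59 · #A = C · #A^60`
  have h1 : (60 • A).card * A.card ^ 60 < Nat.choose (m + 29) 30 * A.card ^ 60 := by
    calc (60 • A).card * A.card ^ 60 ≤ (A + A).card ^ 60 * A.card := hP
      _ < Nat.choose (m + 29) 30 * A.card ^ 59 * A.card := Nat.mul_lt_mul_of_pos_right hA hpos
      _ = Nat.choose (m + 29) 30 * A.card ^ 60 := by ring
  exact Nat.lt_of_mul_lt_mul_right h1

/-- Doubling-constant form: `#(A + A) ≤ K · #A` and `K^60 · #A < C(m+29, 30)` force a relation.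
[cite: TaoVu2006, Cor. 6.29] -/
theorem relation_of_doubling_le {m K : ℕ} (d : Fin m → ℕ) (A : Finset ℕ) (hd : ∀ i, d i ∈ A + A)
    (hK : (A + A).card ≤ K * A.card) (hm : K ^ 60 * A.card < Nat.choose (m + 29) 30) :
    ∃ S T : Multiset (Fin m), S ≠ T ∧ Multiset.card S ≤ 30 ∧ Multiset.card T ≤ 30 ∧
      (S.map d).sum = (T.map d).sum := by
  classical
  rcases A.eq_empty_or_nonempty with rfl | hne
  · rcases Nat.eq_zero_or_pos m with rfl | hm0
    · simp at hm
    · exact absurd (hd ⟨0, hm0⟩) (by simp)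
  refine relation_of_small_doubling d A hd ?_
  have hpos : 0 < A.card := hne.card_pos
  calc (A + A).card ^ 60 ≤ (K * A.card) ^ 60 := Nat.pow_le_pow_left hK 60
    _ = K ^ 60 * A.card * A.card ^ 59 := by ring
    _ < Nat.choose (m + 29) 30 * A.card ^ 59 :=
        Nat.mul_lt_mul_of_pos_right hm (pow_pos hpos 59)

end Doubling

/-! ## Targets of a quadratic polynomial swallowing are pair sums of the pool -/

section Support

variable {K : Type*} [Field K]

/-- A polynomial supported in `A` lies in the span of the monomials `x^a`, `a ∈ A`. [folklore] -/
theorem mem_span_pow_of_support_subset (A : Finset ℕ) (p : K[X]) (hp : p.support ⊆ A) :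
    p ∈ Submodule.span K ((fun a : ℕ => (X : K[X]) ^ a) '' (A : Set ℕ)) := by
  classical
  rw [p.as_sum_support_C_mul_X_pow]
  refine Submodule.sum_mem _ fun i hi => ?_
  rw [← Polynomial.smul_eq_C_mul]
  exact Submodule.smul_mem _ _ (Submodule.subset_span ⟨i, hp hi, rfl⟩)

/-- Products of monomial spans: `span{x^a : a ∈ A} · span{x^b : b ∈ B} ≤ span{x^c : c ∈ A + B}`.
[folklore] -/
theorem span_pow_mul_span_pow_le (A B : Finset ℕ) :
    Submodule.span K ((fun a : ℕ => (X : K[X]) ^ a) '' (A : Set ℕ)) *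
        Submodule.span K ((fun a : ℕ => (X : K[X]) ^ a) '' (B : Set ℕ)) ≤
      Submodule.span K ((fun a : ℕ => (X : K[X]) ^ a) '' ((A + B : Finset ℕ) : Set ℕ)) := by
  classical
  rw [Submodule.span_mul_span]
  refine Submodule.span_le.2 ?_
  rintro _ ⟨_, ⟨a, ha, rfl⟩, _, ⟨b, hb, rfl⟩, rfl⟩
  refine Submodule.subset_span ⟨a + b, ?_, ?_⟩
  · rw [Finset.mem_coe] at ha hb ⊢
    exact Finset.add_mem_add ha hb
  · simp [pow_add]

/-- Coefficient extraction: if `x^d ∈ span{x^a : a ∈ B}` then `d ∈ B`. [folklore] -/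
theorem mem_of_X_pow_mem_span (B : Finset ℕ) (d : ℕ)
    (h : ((X : K[X]) ^ d) ∈ Submodule.span K ((fun a : ℕ => (X : K[X]) ^ a) '' (B : Set ℕ))) :
    d ∈ B := by
  classical
  by_contra hd
  have hzero : ∀ q ∈ Submodule.span K ((fun a : ℕ => (X : K[X]) ^ a) '' (B : Set ℕ)),
      q.coeff d = 0 := by
    intro q hq
    refine Submodule.span_induction ?_ ?_ ?_ ?_ hq
    · rintro _ ⟨a, ha, rfl⟩
      rw [Polynomial.coeff_X_pow, if_neg]
      rintro rfl
      exact hd (Finset.mem_coe.1 ha)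
    · simp
    · intro x y _ _ hx hy
      simp [hx, hy]
    · intro c x _ hx
      simp [hx]
  have h1 := hzero _ h
  simp at h1

/-- **Targets are pair sums of the pool.**  For a quadratic polynomial swallowing `Γ_i(y) = x^{d_i}`
and any finite `A ∋ 0` containing the support of every source, `d_i ∈ A + A`:
`x^{d_i} = Γ_i(y) ∈ span(W·W)` for `W = span(1, y)` (`PolySwallowBornRank.aeval_mem_span_mul_of_totalDegree_le_two`),
`W ≤ span{x^a : a ∈ A}`, products of monomial spans, coefficient extraction. [folklore] -/
theorem target_mem_sumset {m s : ℕ} (d : Fin m → ℕ) (Γ : Fin m → MvPolynomial (Fin s) K)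
    (y : Fin s → K[X]) (hΓ : ∀ i, (Γ i).totalDegree ≤ 2)
    (hy : ∀ i, MvPolynomial.aeval y (Γ i) = (X : K[X]) ^ d i)
    (A : Finset ℕ) (h0 : 0 ∈ A) (hA : ∀ j, (y j).support ⊆ A) (i : Fin m) : d i ∈ A + A := by
  classical
  set W : Submodule K K[X] := Submodule.span K (insert 1 (Set.range y)) with hWdef
  set SA : Submodule K K[X] := Submodule.span K ((fun a : ℕ => (X : K[X]) ^ a) '' (A : Set ℕ))
    with hSAdef
  have hW : W ≤ SA := by
    refine Submodule.span_le.2 ?_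
    rintro p (rfl | ⟨j, rfl⟩)
    · exact Submodule.subset_span ⟨0, Finset.mem_coe.2 h0, by simp⟩
    · exact mem_span_pow_of_support_subset A (y j) (hA j)
  have h1W : (1 : K[X]) ∈ W := Submodule.subset_span (Set.mem_insert _ _)
  have hyW : ∀ j, y j ∈ W := fun j => Submodule.subset_span (Set.mem_insert_of_mem _ ⟨j, rfl⟩)
  have hmem : ((X : K[X]) ^ d i) ∈ Submodule.span K ((W : Set K[X]) * (W : Set K[X])) := by
    rw [← hy i]
    exact PolySwallowBornRank.aeval_mem_span_mul_of_totalDegree_le_two y W h1W hyW (Γ i) (hΓ i)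
  have hle : Submodule.span K ((W : Set K[X]) * (W : Set K[X])) ≤
      Submodule.span K ((fun a : ℕ => (X : K[X]) ^ a) '' ((A + A : Finset ℕ) : Set ℕ)) := by
    refine Submodule.span_le.2 ?_
    rintro _ ⟨p, hp, q, hq, rfl⟩
    have hpq : p * q ∈ SA * SA := Submodule.mul_mem_mul (hW hp) (hW hq)
    exact span_pow_mul_span_pow_le A A hpq
  exact mem_of_X_pow_mem_span (A + A) (d i) (hle hmem)

end Support

/-! ## The sub-regimes of the residual, stub-level -/

/-- **Support-sumset pigeonhole.**  A quadratic polynomial swallowing whose pool `A ∋ 0` (any finite set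
containing the source supports) has `#(60 • A) < C(m+29, 30)` admits a relation of length `≤ 30`,
whatever the honesty of the targets. [folklore] -/
theorem relation_of_support_nsmul {m s : ℕ} (d : Fin m → ℕ) (Γ : Fin m → MvPolynomial (Fin s) ℂ)
    (y : Fin s → ℂ[X]) (hΓ : ∀ i, (Γ i).totalDegree ≤ 2)
    (hy : ∀ i, MvPolynomial.aeval y (Γ i) = (X : ℂ[X]) ^ d i)
    (A : Finset ℕ) (h0 : 0 ∈ A) (hA : ∀ j, (y j).support ⊆ A)
    (hcard : (60 • A).card < Nat.choose (m + 29) 30) :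
    ∃ S T : Multiset (Fin m), S ≠ T ∧ Multiset.card S ≤ 30 ∧ Multiset.card T ≤ 30 ∧
      (S.map d).sum = (T.map d).sum :=
  relation_of_sumset_cover (k := 30) d A (target_mem_sumset d Γ y hΓ hy A h0 hA) hcard

/-- **Small-doubling pool.**  A quadratic polynomial swallowing whose pool `A ∋ 0` has
`#(A + A)^60 < C(m+29, 30) · #A^59` admits a relation of length `≤ 30`, whatever the honesty of the
targets (Plünnecke–Ruzsa + pigeonhole). [cite: TaoVu2006, Cor. 6.29] -/
theorem relation_of_support_doubling {m s : ℕ} (d : Fin m → ℕ) (Γ : Fin m → MvPolynomial (Fin s) ℂ)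
    (y : Fin s → ℂ[X]) (hΓ : ∀ i, (Γ i).totalDegree ≤ 2)
    (hy : ∀ i, MvPolynomial.aeval y (Γ i) = (X : ℂ[X]) ^ d i)
    (A : Finset ℕ) (h0 : 0 ∈ A) (hA : ∀ j, (y j).support ⊆ A)
    (hcard : (A + A).card ^ 60 < Nat.choose (m + 29) 30 * A.card ^ 59) :
    ∃ S T : Multiset (Fin m), S ≠ T ∧ Multiset.card S ≤ 30 ∧ Multiset.card T ≤ 30 ∧
      (S.map d).sum = (T.map d).sum :=
  relation_of_small_doubling d A (target_mem_sumset d Γ y hΓ hy A h0 hA) hcard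

/-- **Girth on the pool.**  For `m ≥ m₀` (`= 4098^25`), a quadratic polynomial swallowing whose pool
`A ∋ 0` has `#A^20 ≤ m^19` admits a relation of length `≤ 30`: `d ⊆ A + A` and the girth engine
`Theorems.stub_coveringGirth` (non-injective `d`: relation `{i} ≠ {j}`).  This is the sparse engine
of item 6539 counted by total support. [cite: BondySimonovits1974, Thm. 1] -/
theorem relation_of_support_card :
    ∃ m₀ : ℕ, ∀ m ≥ m₀, ∀ (d : Fin m → ℕ) (s : ℕ) (Γ : Fin m → MvPolynomial (Fin s) ℂ)
      (y : Fin s → ℂ[X]), (∀ i, (Γ i).totalDegree ≤ 2) →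
        (∀ i, MvPolynomial.aeval y (Γ i) = (X : ℂ[X]) ^ d i) →
        ∀ A : Finset ℕ, 0 ∈ A → (∀ j, (y j).support ⊆ A) → A.card ^ 20 ≤ m ^ 19 →
        ∃ S T : Multiset (Fin m), S ≠ T ∧ Multiset.card S ≤ 30 ∧ Multiset.card T ≤ 30 ∧
          (S.map d).sum = (T.map d).sum := by
  obtain ⟨m₁, hgirth⟩ := stub_coveringGirth
  refine ⟨m₁, fun m hm d s Γ y hΓ hy A h0 hA hcard => ?_⟩
  classical
  by_cases hinj : Function.Injective d
  swap
  · obtain ⟨i, j, hij, hne⟩ := Function.not_injective_iff.1 hinj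
    exact ⟨{i}, {j}, by simpa using hne, by simp, by simp, by simpa using hij⟩
  let Az : Finset ℤ := A.image (fun n : ℕ => (n : ℤ))
  have hAz : Az.card ^ 20 ≤ m ^ 19 :=
    le_trans (Nat.pow_le_pow_left Finset.card_image_le 20) hcard
  have hcov : ∀ i, ∃ a ∈ Az, ∃ b ∈ Az, (d i : ℤ) = a + b := by
    intro i
    obtain ⟨a, ha, b, hb, hab⟩ := Finset.mem_add.1 (target_mem_sumset d Γ y hΓ hy A h0 hA i)
    refine ⟨a, Finset.mem_image.2 ⟨a, ha, rfl⟩, b, Finset.mem_image.2 ⟨b, hb, rfl⟩, ?_⟩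
    rw [← hab]; push_cast; rfl
  exact hgirth m hm d hinj Az hAz hcov

/-- **Shape of a counterexample, pool side.**  For `m ≥ m₀`, a relation-free quadratic polynomial
swallowing with pool `A ∋ 0` (any finite set containing the source supports) has
`#A^20 > m^19`, `#(60 • A) ≥ C(m+29, 30)` and `#(A + A)^60 ≥ C(m+29, 30) · #A^59` — a large pool of
polynomially large doubling whose `60`-fold sumset does not collapse. [folklore] -/
theorem counterexample_support_shape :
    ∃ m₀ : ℕ, ∀ m ≥ m₀, ∀ (d : Fin m → ℕ) (s : ℕ) (Γ : Fin m → MvPolynomial (Fin s) ℂ)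
      (y : Fin s → ℂ[X]), (∀ i, (Γ i).totalDegree ≤ 2) →
        (∀ i, MvPolynomial.aeval y (Γ i) = (X : ℂ[X]) ^ d i) →
        (¬ ∃ S T : Multiset (Fin m), S ≠ T ∧ Multiset.card S ≤ 30 ∧ Multiset.card T ≤ 30 ∧
          (S.map d).sum = (T.map d).sum) →
        ∀ A : Finset ℕ, 0 ∈ A → (∀ j, (y j).support ⊆ A) →
          m ^ 19 < A.card ^ 20 ∧ Nat.choose (m + 29) 30 ≤ (60 • A).card ∧
            Nat.choose (m + 29) 30 * A.card ^ 59 ≤ (A + A).card ^ 60 := by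
  obtain ⟨m₀, hgirth⟩ := relation_of_support_card
  refine ⟨m₀, fun m hm d s Γ y hΓ hy hfree A h0 hA => ⟨?_, ?_, ?_⟩⟩
  · by_contra h
    exact hfree (hgirth m hm d s Γ y hΓ hy A h0 hA (not_lt.1 h))
  · by_contra h
    exact hfree (relation_of_support_nsmul d Γ y hΓ hy A h0 hA (not_le.1 h))
  · by_contra h
    exact hfree (relation_of_support_doubling d Γ y hΓ hy A h0 hA (not_le.1 h))

end PolySwallowSupport

end Summit.ValiantsHypothesis.ValiantsHypothesis.Theorems
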